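import Literature.Analysis.Complex.JensenCircles
import Summits.RiemannHypothesis.RiemannHypothesis.Theorems.Splittings.JensenWindowDeGuaCount
import Summits.RiemannHypothesis.RiemannHypothesis.Theorems.TiltedLandingLaw421R3QuadW
import Summits.RiemannHypothesis.RiemannHypothesis.Theorems.TiltedLandingLaw421Seam01

/-! # LAW 421 kernel: the CLUSTER STEP — an all-in-band cluster in a Jensen window yields an IN-BAND SUCCESSOR inside the window, OR an NL EVENT in its base
(W-08 C4 «kernel desk», rh-idea-6 g27; C3 rh-idea-3 g34 RESULT-1 l.5930 «INV-A: some complete cluster at level j is all-in-band ⇒ BAND_{j+1} ≠ ∅ at once by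
de Gua + hosting … is then two lines»)

THIN COMPOSITION of three tree theorems, nothing more: the LOCAL DICHOTOMY of the Jensen-window census
`…Splittings.JensenWindow.no_nonreal_zero_of_localA_localB` (Kim 1996 Thm 1, count-free corollary: local A ∧ local B on a Jensen window ⇒ no couple inside),
JENSEN'S THEOREM FOR THE DERIVATIVES `Literature.Analysis.Complex.jensen_circle_iteratedDeriv_pos` (Ki–Kim 2000 §2: every upper zero of `f^{(j+1)}` is NESTED —
`RhW08.QuadW.NestedStep` — under an upper zero of `f^{(j)}`), and the BAND MARKOV STEP `RhW08.QuadW.band_step'` (#1019). Glue proved here: `host_mem_window` — by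
the window's Jensen-CLEAR boundary, the host of a successor found INSIDE the open window lies in the CLOSED window (a disc reaching in from outside would cover a
non-real boundary point), so the «cluster all in band» hypothesis applies to it.

★★★ `band_successor_or_nlEvent_of_window`: `f` real entire of order `< 2` with no derivative `≡ 0`; `[α,β] × [−h,h]` a Jensen `Window` for `f^{(j)}` containing a
couple of `f^{(j)}` in its interior; every upper zero of `f^{(j)}` in the CLOSED window in `BAND_j` (`ρ² + j·Im² ≤ j·Hs²`, `Im ≤ Hs`). THEN EITHER `f^{(j+1)}` has an
upper zero `w` in the open window with `w ∈ BAND_{j+1}`, `Im w ≤ Hs` (an in-band SUCCESSOR — `stColQ'_succ_of_window` turns it into a `StColQ' … (j+1) w` state),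
OR there is `c ∈ (α, β)` with `NLEventOf f j c` (the LAW's T-event token, Seam01). Per-pair capture is FALSE (C3 RESULT-1 (1)); this is the per-CLUSTER
(per-window) statement, which is what holds.

v4 (C1 g25 hnz-free variant, see §3′ below): level-`j` hypotheses `iteratedDeriv j f ≠ 0` / `iteratedDeriv (j+1) f ≠ 0` replace `∀ n, iteratedDeriv n f ≠ 0`.
v3: `norm_sq_re_im` (twin of `Literature.Analysis.Complex.ExtremalLengthProofs.norm_sq_eq_re_sq_add_im_sq`, director (CA356) pre-check) is no longer
declared — inlined as a local `have` in `host_mem_window`; no other top-level decl of this file has a landed twin (rg over Literature/ + Summits/).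

§4 (v2, answer to sw-alpha g15's STUCK-LEMMA 07:30Z / director (CA355) «Branch 2»): ★★★ `tiltReady_of_window_noNest` — in the ALL-IN-BAND Jensen-window case,
«no upper zero of `f^{(j+1)}` inside the window is NESTED under a band state of the closed window» + «the window base lies in the LAW's range
`|c − x₀| < (j+3)R/2`» ⇒ `TiltReady` (hence `ReadyR2`) at level `j`: the successor branch of the cluster step is refuted by its Jensen host
(`jensen_circle_iteratedDeriv_pos` + `host_mem_window`: the host is an upper zero of the CLOSED window, i.e. a band state), so the NL branch fires.
CAVEAT (C3 RESULT-1/2, C6-replicated level-4 certificate `e^{γz}((z−a)²+¼)((z−a)²+1)`): WITHOUT the all-in-band hypothesis (a MIXED window: an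
out-of-band couple inside) the hand's Branch-2 lemma «discs of band states free of successors ⇒ ReadyR2» is NOT a theorem — the out-of-band mate hosts
both successors, `J′ = J`, no NL event; that mixed case is the named OPEN remainder (C1 WORDS-66 (S2′)/(S3), C3 approach–decay), not closed here.
Typed/proved ≠ the LAW; nothing here bears on the truth of RH; RH is NOT proved; 24774 OPEN. -/

noncomputable section

open Complex Set
open scoped ComplexConjugate
open Literature.Analysis.Complex
open Summit.RiemannHypothesis.RiemannHypothesis.Theorems.Splittings.JensenWindow
open RhIdea6.G17.W07C7

namespace RhW08.QuadW

/-- ★ (K) HOST IN THE WINDOW: for a Jensen window of `G`, an upper zero `a` of `G` whose closed Jensen disc contains a NON-REAL point `w` of the OPEN window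
(`NestedStep a w`) has `Re a ∈ [α, β]` and `Im a < h` (the boundary is Jensen-clear). -/
theorem host_mem_window {G : ℂ → ℂ} {α β h : ℝ} (hW : Window G α β h) {a w : ℂ} (ha : G a = 0) (hapos : 0 < a.im)
    (hw : w ∈ Ioo α β ×ℂ Ioo (-h) h) (hwim : w.im ≠ 0) (hn : NestedStep a w) :
    a.re ∈ Icc α β ∧ a.im < h := by
  have nsq : ∀ z : ℂ, ‖z‖ ^ 2 = z.re ^ 2 + z.im ^ 2 := fun z => by
    rw [Complex.sq_norm, Complex.normSq_apply]; ring
  have haim : a.im ≠ 0 := hapos.ne'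
  rw [mem_reProdIm] at hw
  obtain ⟨⟨hwα, hwβ⟩, ⟨hwl, hwu⟩⟩ := hw
  unfold NestedStep at hn
  have hre : a.re ∈ Icc α β := by
    constructor
    · by_contra hlt
      push Not at hlt
      have hcl := hW.left w.im ⟨hwl.le, hwu.le⟩ hwim a ha haim
      have h1 : |a.im| ^ 2 < ‖(α : ℂ) + (w.im : ℂ) * I - (a.re : ℂ)‖ ^ 2 := pow_lt_pow_left₀ hcl (abs_nonneg _) two_ne_zero
      have e1 : ((α : ℂ) + (w.im : ℂ) * I - (a.re : ℂ)).re = α - a.re := by simp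
      have e2 : ((α : ℂ) + (w.im : ℂ) * I - (a.re : ℂ)).im = w.im := by simp
      rw [sq_abs, nsq, e1, e2] at h1
      nlinarith [mul_pos (sub_pos.2 hwα) (by linarith : 0 < w.re + α - 2 * a.re)]
    · by_contra hlt
      push Not at hlt
      have hcl := hW.right w.im ⟨hwl.le, hwu.le⟩ hwim a ha haim
      have h1 : |a.im| ^ 2 < ‖(β : ℂ) + (w.im : ℂ) * I - (a.re : ℂ)‖ ^ 2 := pow_lt_pow_left₀ hcl (abs_nonneg _) two_ne_zero
      have e1 : ((β : ℂ) + (w.im : ℂ) * I - (a.re : ℂ)).re = β - a.re := by simp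
      have e2 : ((β : ℂ) + (w.im : ℂ) * I - (a.re : ℂ)).im = w.im := by simp
      rw [sq_abs, nsq, e1, e2] at h1
      nlinarith [mul_pos (sub_pos.2 hwβ) (by linarith : 0 < 2 * a.re - w.re - β)]
  refine ⟨hre, ?_⟩
  have hcl := hW.top a.re hre a ha haim
  have e : (a.re : ℂ) + (h : ℂ) * I - (a.re : ℂ) = (h : ℂ) * I := by ring
  rw [e, norm_mul, Complex.norm_I, mul_one, Complex.norm_real, Real.norm_eq_abs, abs_of_pos hW.pos, abs_of_pos hapos] at hcl
  exact hcl

/-- (K) failure of LOCAL B at level `j` is an NL event of the LAW. -/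
theorem nlEventOf_of_not_localB {f : ℂ → ℂ} (hf : RealEntireLt2 f) (j : ℕ) {α β : ℝ} (hB : ¬ LocalB (iteratedDeriv j f) α β) :
    ∃ c ∈ Ioo α β, NLEventOf f j c := by
  unfold LocalB at hB
  push Not at hB
  obtain ⟨c, hc, hd, h0, hle⟩ := hB
  have hreal : ∀ x : ℝ, (iteratedDeriv j f x).im = 0 := im_iteratedDeriv_ofReal hf.diff hf.real j
  have e1 : deriv (iteratedDeriv j f) = iteratedDeriv (j + 1) f := by rw [← iteratedDeriv_succ]
  have e2 : deriv (deriv (iteratedDeriv j f)) = iteratedDeriv (j + 2) f := by rw [e1, ← iteratedDeriv_succ]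
  refine ⟨c, hc, ?_, ?_, ?_⟩
  · rw [← e1, hd, Complex.zero_re]
  · intro h
    exact h0 (Complex.ext (by simpa using h) (by simpa using hreal c))
  · rw [Complex.mul_re, hreal c, zero_mul, sub_zero, e2] at hle
    exact hle

/-! ### v4 = the hnz-free variant (C1 g25 FLAG 07:37Z, image a8ad3ddb, adopted by C4 as the landing image): `hnz : ∀ n, iteratedDeriv n f ≠ 0` of v1–v3 is
replaced by the level-`j` hypothesis `hGne : iteratedDeriv j f ≠ 0` (resp. `iteratedDeriv (j+1) f ≠ 0` in `stColQ'_succ_of_window`) — the `EngineHyps5` class contains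
real polynomial frames, for which `∀ n` fails; Jensen at level `j` needs only `Literature.Analysis.Complex.jensen_circle_pos` on `f^{(j)}`. Two helper lemmas
(`iteratedDeriv_succ_ne_zero_of_zero`, `jensen_host_levelj`, C1 g25) added; everything else is v3 54124c75 byte-for-byte. -/

/-- (C1 g25) a zero `u` of `G = f^{(j)} ≢ 0` makes `G' = f^{(j+1)} ≢ 0` (non-constancy). -/
theorem iteratedDeriv_succ_ne_zero_of_zero {f : ℂ → ℂ} (hf : Differentiable ℂ f) (j : ℕ) (hGne : iteratedDeriv j f ≠ 0)
    {u : ℂ} (hGu : iteratedDeriv j f u = 0) : iteratedDeriv (j + 1) f ≠ 0 := by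
  intro h0
  have hdj : Differentiable ℂ (iteratedDeriv j f) := differentiable_iteratedDeriv_of_entire hf j
  have h1 : deriv (iteratedDeriv j f) = 0 := by rw [← iteratedDeriv_succ]; exact h0
  have hconst : ∀ z : ℂ, iteratedDeriv j f z = iteratedDeriv j f u := fun z =>
    is_const_of_deriv_eq_zero hdj (fun x => by rw [h1]; rfl) z u
  exact hGne (funext fun z => by rw [hconst z, hGu]; rfl)

/-- (C1 g25) JENSEN HOST AT LEVEL `j` without `∀ n, f^{(n)} ≢ 0`: an upper zero `w` of `f^{(j+1)}` is nested under an upper zero of `f^{(j)}`,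
provided `f^{(j)} ≢ 0` has some zero (tree `jensen_circle_pos` + `exists_growth_iteratedDeriv`). -/
theorem jensen_host_levelj {f : ℂ → ℂ} (hf : RealEntireLt2 f) (j : ℕ) (hGne : iteratedDeriv j f ≠ 0) {u : ℂ} (hGu : iteratedDeriv j f u = 0)
    {w : ℂ} (hwpos : 0 < w.im) (hfw : iteratedDeriv (j + 1) f w = 0) :
    ∃ a : ℂ, iteratedDeriv j f a = 0 ∧ 0 < a.im ∧ (w.re - a.re) ^ 2 + w.im ^ 2 ≤ a.im ^ 2 := by
  obtain ⟨ρ, C, hρ0, hρ, hgr⟩ := hf.growth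
  obtain ⟨ρ', C', hρ'0, hρ', hgr'⟩ := exists_growth_iteratedDeriv hf.diff hρ0 hρ hgr j
  have hne1 := iteratedDeriv_succ_ne_zero_of_zero hf.diff j hGne hGu
  have hf' : ∃ z, deriv (iteratedDeriv j f) z ≠ 0 := by
    rw [← iteratedDeriv_succ]; exact Function.ne_iff.1 hne1
  have hfw' : deriv (iteratedDeriv j f) w = 0 := by rw [← iteratedDeriv_succ]; exact hfw
  exact jensen_circle_pos (differentiable_iteratedDeriv_of_entire hf.diff j) hρ'0 hρ' hgr'
    (im_iteratedDeriv_ofReal hf.diff hf.real j) hf' hwpos hfw'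

/-- ★★★ THE CLUSTER STEP. See the module docstring. (v4, C1 g25 variant: `hGne : iteratedDeriv j f ≠ 0` in place of `hnz : ∀ n, …`.) -/
theorem band_successor_or_nlEvent_of_window {f : ℂ → ℂ} (hf : RealEntireLt2 f) {j : ℕ} (hGne : iteratedDeriv j f ≠ 0)
    {α β h x₀ R Hs : ℝ} (hW : Window (iteratedDeriv j f) α β h)
    (hJ : ∃ u ∈ Ioo α β ×ℂ Ioo (-h) h, iteratedDeriv j f u = 0 ∧ u.im ≠ 0)
    (hband : ∀ a : ℂ, iteratedDeriv j f a = 0 → 0 < a.im → a.re ∈ Icc α β → a.im ≤ h →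
      (max (|a.re - x₀| - R / 2) 0) ^ 2 + (j : ℝ) * a.im ^ 2 ≤ (j : ℝ) * Hs ^ 2 ∧ a.im ≤ Hs) :
    (∃ w ∈ Ioo α β ×ℂ Ioo (-h) h, iteratedDeriv (j + 1) f w = 0 ∧ 0 < w.im ∧
        (max (|w.re - x₀| - R / 2) 0) ^ 2 + ((j : ℝ) + 1) * w.im ^ 2 ≤ ((j : ℝ) + 1) * Hs ^ 2 ∧ w.im ≤ Hs) ∨
      (∃ c ∈ Ioo α β, NLEventOf f j c) := by
  set G : ℂ → ℂ := iteratedDeriv j f with hGdef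
  have hG : RealEntireLt2 G :=
    { diff := differentiable_iteratedDeriv_of_entire hf.diff j
      growth := by
        obtain ⟨ρ, C, hρ0, hρ, hgr⟩ := hf.growth
        obtain ⟨ρ', C', h1, h2, h3⟩ := exists_growth_iteratedDeriv hf.diff hρ0 hρ hgr j
        exact ⟨ρ', C', h1, h2, h3⟩
      real := im_iteratedDeriv_ofReal hf.diff hf.real j }
  have e1 : deriv G = iteratedDeriv (j + 1) f := by rw [hGdef, ← iteratedDeriv_succ]
  by_cases hB : LocalB G α β
  swap
  · exact Or.inr (nlEventOf_of_not_localB hf j hB)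
  by_cases hA : LocalA G α β h
  · -- local A ∧ local B ⇒ no couple in the open window: contradicts `hJ`
    exfalso
    obtain ⟨u, hu, hGu, huim⟩ := hJ
    exact huim (no_nonreal_zero_of_localA_localB hG hW hA hB u hu hGu)
  -- ¬ local A: a NON-REAL zero of `G' = f^{(j+1)}` in the open window; reflect it to the upper half-plane
  left
  unfold LocalA at hA
  push Not at hA
  obtain ⟨ρ, hρ, hdρ, hρim⟩ := hA
  have hdreal : ∀ x : ℝ, (deriv G x).im = 0 := im_deriv_ofReal hG.diff hG.real
  obtain ⟨w, hw, hdw, hwpos⟩ : ∃ w ∈ Ioo α β ×ℂ Ioo (-h) h, deriv G w = 0 ∧ 0 < w.im := by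
    rcases lt_or_gt_of_ne hρim with hneg | hpos
    · refine ⟨conj ρ, ?_, ?_, ?_⟩
      · rw [mem_reProdIm] at hρ ⊢
        obtain ⟨h1, h2, h3⟩ := hρ
        refine ⟨by simpa using h1, ?_, ?_⟩
        · simp only [Complex.conj_im]; linarith [h3]
        · simp only [Complex.conj_im]; linarith [h2]
      · rw [apply_conj_eq_conj (differentiable_deriv hG.diff) hdreal ρ, hdρ, map_zero]
      · simpa using hneg
    · exact ⟨ρ, hρ, hdρ, hpos⟩
  have hfw : iteratedDeriv (j + 1) f w = 0 := by rw [← e1]; exact hdw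
  obtain ⟨u₀, -, hGu₀, -⟩ := hJ
  obtain ⟨a, ha, hapos, hn⟩ := jensen_host_levelj hf j hGne hGu₀ hwpos hfw
  have hn' : NestedStep a w := hn
  obtain ⟨hare, hah⟩ := host_mem_window hW ha hapos hw hwpos.ne' hn'
  obtain ⟨hq, haHs⟩ := hband a ha hapos hare hah.le
  have haHs2 : a.im ^ 2 ≤ Hs ^ 2 := pow_le_pow_left₀ hapos.le haHs 2
  have hstep := band_step' hq haHs2 hn'
  refine ⟨w, hw, hfw, hwpos, hstep, ?_⟩
  unfold NestedStep at hn'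
  nlinarith [sq_nonneg (w.re - a.re)]

/-- ★ (K) the successor of the first branch IS a `StColQ'` state of level `j+1` (band-window class of #1019). -/
theorem stColQ'_succ_of_window {f : ℂ → ℂ} {j : ℕ} (hne1 : iteratedDeriv (j + 1) f ≠ 0) {x₀ R Hs : ℝ} (η s hmax : ℝ) (B : ℕ) {w : ℂ}
    (hfw : iteratedDeriv (j + 1) f w = 0) (hwpos : 0 < w.im)
    (hband : (max (|w.re - x₀| - R / 2) 0) ^ 2 + ((j : ℝ) + 1) * w.im ^ 2 ≤ ((j : ℝ) + 1) * Hs ^ 2) (hwHs : w.im ≤ Hs) :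
    StColQ' η f x₀ s hmax R Hs B (j + 1) w := by
  refine ⟨hne1, hfw, hwpos, ?_, hwHs⟩
  push_cast
  exact hband

/-! ## §4 Branch 2 of `stub_restSuccBotQ` in the all-in-band Jensen-window case (sw-alpha g15 STUCK-LEMMA 07:30Z; director (CA355)) -/

/-- ★★★ **BRANCH 2, ALL-IN-BAND WINDOW.** `f` real entire of order `< 2`, no derivative `≡ 0`; a Jensen `Window` of `f^{(j)}` with a couple inside, every upper zero of
the CLOSED window in `BAND_j` (`Im ≤ Hs`), NO upper zero of `f^{(j+1)}` in the open window NESTED under an upper zero of `f^{(j)}` of the closed window (the hand's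
«Jensen discs of the band states are free of successors», restricted to the window), and the window base inside the LAW's range. THEN `TiltReady` and `ReadyR2`
hold at level `j` (for every state `u`: both are state-free). -/
theorem tiltReady_of_window_noNest {f : ℂ → ℂ} (hf : RealEntireLt2 f) {j : ℕ} (hGne : iteratedDeriv j f ≠ 0)
    {α β h x₀ R Hs : ℝ} (η s hmax : ℝ) (B : ℕ) (u : ℂ) (hW : Window (iteratedDeriv j f) α β h)
    (hJ : ∃ v ∈ Ioo α β ×ℂ Ioo (-h) h, iteratedDeriv j f v = 0 ∧ v.im ≠ 0)
    (hband : ∀ a : ℂ, iteratedDeriv j f a = 0 → 0 < a.im → a.re ∈ Icc α β → a.im ≤ h →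
      (max (|a.re - x₀| - R / 2) 0) ^ 2 + (j : ℝ) * a.im ^ 2 ≤ (j : ℝ) * Hs ^ 2 ∧ a.im ≤ Hs)
    (hnoNest : ∀ a : ℂ, iteratedDeriv j f a = 0 → 0 < a.im → a.re ∈ Icc α β → a.im ≤ h →
      ∀ w ∈ Ioo α β ×ℂ Ioo (-h) h, iteratedDeriv (j + 1) f w = 0 → 0 < w.im → ¬ NestedStep a w)
    (hrange : ∀ c ∈ Ioo α β, |c - x₀| < ((j : ℝ) + 3) * R / 2) :
    RhW08.StSwap.TiltReady η f x₀ s hmax R Hs B j u ∧ RhW08.StSwap.ReadyR2 η f x₀ s hmax R Hs B j u := by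
  have htilt : RhW08.StSwap.TiltReady η f x₀ s hmax R Hs B j u := by
    rcases band_successor_or_nlEvent_of_window (x₀ := x₀) (R := R) (Hs := Hs) hf hGne hW hJ hband with
      ⟨w, hw, hfw, hwpos, -, -⟩ | ⟨c, hc, hNL⟩
    · -- the successor is hosted (Jensen) by an upper zero of the CLOSED window — a band state: contradiction with `hnoNest`
      exfalso
      obtain ⟨u₀, -, hGu₀, -⟩ := hJ
      obtain ⟨a, ha, hapos, hn⟩ := jensen_host_levelj hf j hGne hGu₀ hwpos hfw
      have hn' : NestedStep a w := hn
      obtain ⟨hare, hah⟩ := host_mem_window hW ha hapos hw hwpos.ne' hn'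
      exact hnoNest a ha hapos hare hah.le w hw hfw hwpos hn'
    · exact ⟨c, hrange c hc, hNL⟩
  exact ⟨htilt, RhIdea6.G20.W07C12.Frac.cumReady_of_ready (Ready := RhW08.StSwap.WinOrTilt) (Or.inr htilt)⟩

end RhW08.QuadW
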